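import Summits.Langlands.Langlands.Theses.SenNullAlignment
import Literature.NumberTheory.GaloisRepresentations.Pseudocharacter

/-!
# Birth skeleton (BC3) for crux stmt-Langlands-16362
`Summit.Langlands.Langlands.Theses.SenNullAlignment.OddNonRegularAttached` — line `birth`

Route `route-Langlands-SenNullAlignment` (crux #6, rank 9; a LITERATURE TRANSCRIPTION, grounded as the
named fact `Literature.NumberTheory.Automorphic.exists_galoisRep_GL2_totallyReal_partialWeightOne`,
p121037). The crux: for `K` totally real and `π` cuspidal on `GL₂(𝔸_K)`, `L`-algebraic, holomorphic of
weight `(k, w)` (the inlined `hilbertInfinityType k w`), with totally odd central sign and SOME `k_β = 1`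
(partial or parallel weight one), and for every `ℓ`, `ι : ℚ̄_ℓ ≃ ℂ`, there is an IRREDUCIBLE continuous
`ρ : Γ_K → GL₂(ℚ̄_ℓ)` which is Satake–Frobenius compatible with `π` at almost all finite places
(`Summit.Langlands.SatakeFrobCompatibleAt`: `π_v` unramified with parameter `α`, `ρ` unramified at `v`,
`charpoly ρ(Frob_v) = arithFrobPolyOfSatake ι q_v 1 α`).

The line `birth` is the printed proof of Jarvis 1997, Thm. 6.1 (held text
`paper:doi-10-1515-crll-1997-491-199`, proof on pp. 15–16: "there is a continuous pseudorepresentation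
`r_n : Gal(F_Σ/F) → T_{k_n,w_n}(m) ⊗ ℤ_ℓ` … `R_n = α_n ∘ r_n` … the limit `R : Gal(F_Σ/F) → 𝒪_{K,λ}` is also
a pseudorepresentation, and clearly satisfies `tr R(Frob_q) = θ_f(T_q)` for `q ∤ mℓ` … As `R` is a
pseudorepresentation, it lifts to a genuine representation `ρ_λ : Gal(F_Σ/F) → GL₂(K_λ)` with the same
trace as `R`"), followed by Ribet's irreducibility argument (op. cit. end of §3, p. 8: "Ribet, in a letter
to Carayol (unpublished), has proven that if the representations exist, then they are irreducible";
Newton 2015, after Thm. 1, p. 3 of `paper:arxiv-1409.6535`: "proved using an argument of Ribet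
[RibetIrred] (see [TaylorII])"), cut into its three moves, each a closed statement over tree declarations:

* `stub_heckePseudocharacter` — **Hecke congruences ⇒ an `ℓ`-adic pseudocharacter carrying the Satake
  data of `π`** (L; the automorphic engine: multiplication by lifts of Hasse invariants / Taylor's
  congruences into REGULAR weights where the Galois representations exist, Hecke-algebra-valued
  pseudorepresentations, Wiles's gluing of the `R_n` modulo `λ^{n+1}`). Output, in Taylor's formalism
  (tree `ContinuousPseudocharacter`): a continuous `2`-dimensional pseudocharacter `T : Γ_K → ℚ̄_ℓ` with
  values in a finite `E/ℚ_ℓ` (the `λ`-adic completion of the Hecke field, through `ι`), a finite set `S`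
  of places (`v ∣ 𝔫ℓ`) with every inertia group outside `S` inside Taylor's kernel `T.ker`, and at every
  `v ∉ S` a Satake parameter `α_v` of `π` with `X² - T(σ)X + (T(σ)² - T(σ²))/2 = arithFrobPolyOfSatake ι
  q_v 1 α_v` for every arithmetic Frobenius `σ` at every `𝔓 ∣ v` (trace AND determinant: Jarvis's
  `tr R(Frob_q) = θ_f(T_q)`, `det = χ`, in the `L`-normalisation of the route).
* `stub_repOfPseudocharacter` — **Taylor's reconstruction with the local bookkeeping** (M; pure Galois
  side, any number field): a continuous `2`-dimensional pseudocharacter `T` of `Γ_K` over `ℚ̄_ℓ` with values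
  in a finite `E/ℚ_ℓ`, whose kernel contains the inertia groups outside `S` and whose Frobenius polynomial
  at `v ∉ S` is `P v`, is the trace of a continuous SEMISIMPLE `ρ : Γ_K → GL₂(ℚ̄_ℓ)` which is unramified
  outside `S` with `charpoly ρ(Frob_v) = P v` there. Ingredients: Taylor 1991 Thm. 1 (tree named facts
  `Hida2000_thm_2_18_1`, `BellaicheChenevier2009_continuous_rep_of_pseudocharacter`), non-degeneracy of
  the trace form on the semisimple algebra `ℚ̄_ℓ[ρ(Γ_K)]` (inertia in `ker T` ⇒ `ρ(I_𝔓) = 1`), and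
  `det M = (tr M² - tr (M²))/2` for `2 × 2` matrices (Cayley–Hamilton).
* `stub_cuspidalIrreducible` — **Ribet's irreducibility** (M–L): every continuous `ρ : Γ_K → GL₂(ℚ̄_ℓ)`
  that is Satake–Frobenius compatible at almost all places with a cuspidal `π` as in the crux is
  irreducible (no semisimplicity hypothesis is needed: a reducible `ρ` has Jordan–Hölder characters
  `χ₁, χ₂` with `χ₁ + χ₂ = tr ρ`, `χ₁χ₂ = det ρ` on Frobenii, and the argument — `E`-rationality of the
  Frobenius polynomials, local algebraicity of `E`-rational abelian `ℓ`-adic representations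
  (Serre III-20 / Henniart 1982), CM-freeness of totally real `K` (`χᵢ = εᵢ · χ_ℓ^{mᵢ}`), and the pole of
  `L^S(s, π ⊗ ε₁⁻¹)` against cuspidality — only reads those).
* `OddNonRegularAttached_of` — the composition, kernel-checked, concluding the route decl BY NAME: build
  `T` (stub 1), choose the Satake parameters off `S` and set `P v := arithFrobPolyOfSatake ι q_v 1 α_v`,
  reconstruct `ρ` (stub 2), read `∀ᶠ v in cofinite, SatakeFrobCompatibleAt ι π ρ v` off `S.Finite`, and
  apply stub 3 to this `ρ`.

Disproof used: none on file (`ledger crux ls stmt-Langlands-16362`: no `Disproof.lean`, no `Negative/`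
lemmas, no ideas, 2026-08-17). Negatives index (`ledger negatives --problem Langlands`, 3 entries:
SplitPrimeInduction deinduction, OrdinaryPrimeTransport.RankinSelbergPoleCount, K3KugaSatakeDescent
Serre-type anchor): none is a stub here; every conclusion fixes `n = 2` (and stubs 1, 3 a totally real
base field), so the `n = 0` degeneracy that killed RankinSelbergPoleCount cannot occur. The stubs are
CONSEQUENCES of the crux only in the weak sense that stubs 1 and 3 follow from reciprocity for `GL₂/K`;
none implies the crux or the summit cheaply (BC3 probes: `Lines/birth.md`, registrar's NOTES.md).

Shape (for `ledger skeleton check`): stubs `theorem stub_<name> : <signature> := by sorry` stated over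
tree declarations only (fully qualified, as in the route file); `_Goal.stub_<name> : Prop := type_of%
@stub_<name>` names each statement; `OddNonRegularAttached_of (hT : _Goal.stub_heckePseudocharacter)
(hR : _Goal.stub_repOfPseudocharacter) (hI : _Goal.stub_cuspidalIrreducible) : OddNonRegularAttached` is
proved without `sorry`.
-/

set_option linter.dupNamespace false
set_option linter.unusedVariables false

noncomputable section

namespace Summit.Langlands.Langlands.Cruxes.OddNonRegularAttached.Birth

open Summit.Langlands.Langlands.Theses.SenNullAlignment
open Literature.NumberTheory.GaloisRepresentations Literature.NumberTheory.Automorphic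
open NumberField IsDedekindDomain
open scoped Classical

/-! ## 1. The three stubs -/

/-- **STUB 1 — Hecke congruences give an `ℓ`-adic pseudocharacter carrying the Satake data of `π`
(the automorphic engine; L, in print).** For `K` totally real and `π` cuspidal on `GL₂(𝔸_K)`,
`L`-algebraic, holomorphic of weight `(k, w)` (inlined `hilbertInfinityType k w`), totally odd, with some
`k_β = 1`, and for every `ℓ`, `ι : ℚ̄_ℓ ≃ ℂ`: there are a subfield `E ⊆ ℚ̄_ℓ` finite over `ℚ_ℓ`, a finite set
`S` of finite places and a continuous `2`-dimensional pseudocharacter `T : Γ_K → ℚ̄_ℓ` (Taylor) with values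
in `E` such that, at every `v ∉ S`: every inertia group `I_𝔓 ≤ Γ_K`, `𝔓 ∣ v`, lies in Taylor's kernel
`ker T = {h | ∀ g, T(gh) = T(g)}`, and `π` has a Satake parameter `α` at `v` with
`X² - T(σ)·X + (T(σ)² - T(σ²))/2 = ∏_{a ∈ α} (X - ι⁻¹(a⁻¹))` (`arithFrobPolyOfSatake ι q_v 1 α`, the
polynomial of the summit's `SatakeFrobCompatibleAt`) for every arithmetic Frobenius `σ` at `𝔓`.
Printed proof: Jarvis 1997, proof of Thm. 6.1 (pp. 15–16 of the held text): Hecke-algebra-valued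
pseudorepresentations `r_n` in the regular weights `(k_n, w_n)` (Carayol, Taylor 1989 Prop. 1,
Blasius–Rogawski), pushed to `𝒪_{K,λ}/λ^{n+1}` along `θ_f` (Jarvis Prop. 5.3: the congruences produced by
multiplication with weight-shifting forms) and glued (Wiles 1988) to `R : Gal(F_Σ/F) → 𝒪_{K,λ}` with
`tr R(Frob_q) = θ_f(T_q)`, `det = χ`, for `q ∤ mℓ`; parallel weight one is covered by the same
congruence argument (and by Rogawski–Tunnell 1983). `E` = the closure of `ι⁻¹` of the Hecke field of `π`
(a number field). The twist bookkeeping from Jarvis's `T_q, S_q`-eigenvalues to the `L`-normalised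
`arithFrobPolyOfSatake ι q_v 1 α` is that of the tree's regular statement
(`galoisRep_GL2_totallyReal_localGlobal`) and is part of the stub.
[cite: Jarvis1997, Thm. 6.1, proof pp. 15–16 (pseudorepresentations R_n, limit R)]
[cite: TaylorInventMath1989, Prop. 1 and §2] [cite: Wiles1988, §2.2 (pseudo-representations)]
[cite: RogawskiTunnell1983, Thm. (parallel weight one)] -/
theorem stub_heckePseudocharacter :
    ∀ (K : Type) [Field K] [NumberField K], NumberField.IsTotallyReal K →
      ∀ (hcpt : Literature.NumberTheory.Automorphic.isCompact_glFiniteIntegralLevel 2 K)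
        (π : Literature.NumberTheory.Automorphic.CuspidalAutomorphicRepData 2 K hcpt)
        (k : (K →+* ℂ) → ℕ) (w : ℤ), π.1.IsLAlgebraic →
        π.1.HasInfinityType (fun β : K →+* ℂ => ({(⟨((k β : ℂ) - 1 - w) / 2, (1 - (k β : ℂ) - w) / 2,
          (k β : ℤ) - 1, by push_cast; ring⟩ : Literature.NumberTheory.Automorphic.ArchWeight),
          (⟨((k β : ℂ) - 1 - w) / 2, (1 - (k β : ℂ) - w) / 2, (k β : ℤ) - 1, by push_cast; ring⟩ :
            Literature.NumberTheory.Automorphic.ArchWeight).swap} :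
              Multiset Literature.NumberTheory.Automorphic.ArchWeight)) →
        (∀ (u : NumberField.InfinitePlace K), ∀ φ ∈ π.1.W,
          Literature.NumberTheory.Automorphic.rightTranslation
              (Literature.NumberTheory.Automorphic.AdelicGroupData.gl 2 K)
              (Matrix.GeneralLinearGroup.scalar (Fin 2) (Units.map (MonoidHom.inl
                (NumberField.InfiniteAdeleRing K) (IsDedekindDomain.FiniteAdeleRing
                  (NumberField.RingOfIntegers K) K) : NumberField.InfiniteAdeleRing K →*
                    NumberField.AdeleRing (NumberField.RingOfIntegers K) K)
                (Units.map (MonoidHom.mulSingle (fun u' : NumberField.InfinitePlace K => u'.Completion)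
                  u : u.Completion →* NumberField.InfiniteAdeleRing K) (-1)))) φ + φ ∈ π.1.W') →
        (∃ β : K →+* ℂ, k β = 1) →
        ∀ (ℓ : ℕ) [Fact ℓ.Prime] (ι : PadicAlgCl ℓ ≃+* ℂ),
          ∃ (E : IntermediateField ℚ_[ℓ] (PadicAlgCl ℓ))
            (S : Set (IsDedekindDomain.HeightOneSpectrum (NumberField.RingOfIntegers K)))
            (T : Literature.NumberTheory.GaloisRepresentations.ContinuousPseudocharacter
              (Field.absoluteGaloisGroup K) (PadicAlgCl ℓ) 2),
            FiniteDimensional ℚ_[ℓ] E ∧ S.Finite ∧ (∀ g : Field.absoluteGaloisGroup K, T g ∈ E) ∧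
            ∀ v ∉ S, ∃ α : Multiset ℂ, π.1.HasSatakeParamAt v α ∧
              ∀ 𝔓 ∈ v.primesAbove,
                𝔓.inertia (Field.absoluteGaloisGroup K) ≤ T.ker ∧
                ∀ σ : Field.absoluteGaloisGroup K, IsArithFrobAt (NumberField.RingOfIntegers K) σ 𝔓 →
                  Polynomial.X ^ 2 - Polynomial.C (T σ) * Polynomial.X +
                      Polynomial.C ((T σ ^ 2 - T (σ ^ 2)) / 2) =
                    Literature.NumberTheory.Automorphic.arithFrobPolyOfSatake ι v.residueCard 1 α := by
  sorry

/-- **STUB 2 — Taylor's reconstruction theorem with the local bookkeeping (pure Galois side; M).**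
Let `K` be any number field, `ℓ` a prime, `E ⊆ ℚ̄_ℓ` finite over `ℚ_ℓ`, `S` a set of finite places,
`T : Γ_K → ℚ̄_ℓ` a continuous `2`-dimensional pseudocharacter with values in `E`, and
`P : v ↦ P_v ∈ ℚ̄_ℓ[X]`; assume that at every `v ∉ S` the inertia groups `I_𝔓`, `𝔓 ∣ v`, lie in Taylor's
kernel of `T` and `X² - T(σ)X + (T(σ)² - T(σ²))/2 = P_v` for every arithmetic Frobenius `σ` at `𝔓`. Then
there is a continuous SEMISIMPLE `ρ : Γ_K → GL₂(ℚ̄_ℓ)` with `tr ρ = T`, unramified at every `v ∉ S`, with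
`charpoly ρ(Frob_v) = P_v` there. Proof in print-sized pieces: Taylor 1991 Thm. 1 in its continuous
`ℓ`-adic form (tree named facts `Hida2000_thm_2_18_1`, `BellaicheChenevier2009_continuous_rep_of_pseudocharacter`:
a semisimple continuous `ρ` with `tr ρ = T`); for `τ ∈ I_𝔓 ⊆ ker T`, `tr(ρ(g)(ρ(τ) - 1)) = 0` for all `g`,
and the trace form of the semisimple algebra `ℚ̄_ℓ[ρ(Γ_K)] ⊆ M₂(ℚ̄_ℓ)` is non-degenerate in characteristic
`0`, so `ρ(τ) = 1`; finally `charpoly ρ(σ) = X² - tr ρ(σ) X + det ρ(σ)` and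
`det ρ(σ) = (tr ρ(σ)² - tr ρ(σ²))/2` (Cayley–Hamilton for `2 × 2` matrices). This is exactly Jarvis's
line "As `R` is a pseudorepresentation, it lifts to a genuine representation … with the same trace as `R`"
(p. 16) made explicit.
[cite: Taylor1991, §1 Theorem 1] [cite: Hida2000, §2.2.2 Theorem 2.18 (1), (3)]
[cite: BellaicheChenevier2009, §4.2.2] [cite: Jarvis1997, proof of Thm. 6.1, p. 16] -/
theorem stub_repOfPseudocharacter :
    ∀ (K : Type) [Field K] [NumberField K] (ℓ : ℕ) [Fact ℓ.Prime]
      (E : IntermediateField ℚ_[ℓ] (PadicAlgCl ℓ)), FiniteDimensional ℚ_[ℓ] E →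
      ∀ (S : Set (IsDedekindDomain.HeightOneSpectrum (NumberField.RingOfIntegers K)))
        (T : Literature.NumberTheory.GaloisRepresentations.ContinuousPseudocharacter
          (Field.absoluteGaloisGroup K) (PadicAlgCl ℓ) 2),
        (∀ g : Field.absoluteGaloisGroup K, T g ∈ E) →
        ∀ (P : IsDedekindDomain.HeightOneSpectrum (NumberField.RingOfIntegers K) →
          Polynomial (PadicAlgCl ℓ)),
          (∀ v ∉ S, ∀ 𝔓 ∈ v.primesAbove,
            𝔓.inertia (Field.absoluteGaloisGroup K) ≤ T.ker ∧
            ∀ σ : Field.absoluteGaloisGroup K, IsArithFrobAt (NumberField.RingOfIntegers K) σ 𝔓 →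
              Polynomial.X ^ 2 - Polynomial.C (T σ) * Polynomial.X +
                Polynomial.C ((T σ ^ 2 - T (σ ^ 2)) / 2) = P v) →
          ∃ ρ : Literature.NumberTheory.GaloisRepresentations.FramedGaloisRep K (PadicAlgCl ℓ) 2,
            ρ.toGaloisRep.IsSemisimple ∧
            (∀ g : Field.absoluteGaloisGroup K,
              Literature.NumberTheory.GaloisRepresentations.FramedRep.trace ρ g = T g) ∧
            ∀ v ∉ S, ρ.IsUnramifiedAt v ∧ ρ.HasFrobCharpolyAt v (P v) := by
  sorry

/-- **STUB 3 — Ribet's irreducibility (M–L).** For `K` totally real and `π` cuspidal on `GL₂(𝔸_K)`,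
`L`-algebraic, holomorphic of weight `(k, w)`, totally odd, with some `k_β = 1`, and every `ℓ`, `ι`:
EVERY continuous `ρ : Γ_K → GL₂(ℚ̄_ℓ)` that is Satake–Frobenius compatible with `π` at almost all places is
irreducible. No semisimplicity hypothesis: if `ρ` is reducible, its Jordan–Hölder characters `χ₁, χ₂`
(continuous, unramified wherever `ρ` is) satisfy `χ₁ + χ₂ = tr ρ`, `χ₁ χ₂ = det ρ` on Frobenii, and the
printed argument reads only these: the Frobenius polynomials are rational over the Hecke field (a number
field), so `χ₁ ⊕ χ₂` is an `E`-rational abelian `ℓ`-adic representation, hence locally algebraic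
(Serre, Henniart 1982), hence `χᵢ = εᵢ χ_ℓ^{mᵢ}` with `εᵢ` of finite order (`K` totally real has no CM
types); then `L^S(s, π ⊗ ε₁⁻¹)` acquires the pole of `ζ_K^S(s - m₁')` (taking `m₁ ≥ m₂`, the other factor
does not vanish there), contradicting the holomorphy of the `L`-function of the CUSPIDAL `π ⊗ ε₁⁻¹`.
In print: Ribet 1977 Thm. 2.3 (over `ℚ`); for Hilbert modular forms "Ribet, in a letter to Carayol
(unpublished), has proven that if the representations exist, then they are irreducible" (Jarvis 1997,
end of §3, p. 8); Newton 2015, remark after Thm. 1 (p. 3): "proved using an argument of Ribet (see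
[TaylorII])".
[cite: Ribet1977Nebentypus, Thm. 2.3] [cite: Jarvis1997, end of §3 (p. 8)]
[cite: Newton2015LowWeight, Thm. 1 and the remark following it] [cite: Taylor1995HMFII, §1]
[cite: Henniart1982, Thm. (local algebraicity of E-rational abelian ℓ-adic representations)] -/
theorem stub_cuspidalIrreducible :
    ∀ (K : Type) [Field K] [NumberField K], NumberField.IsTotallyReal K →
      ∀ (hcpt : Literature.NumberTheory.Automorphic.isCompact_glFiniteIntegralLevel 2 K)
        (π : Literature.NumberTheory.Automorphic.CuspidalAutomorphicRepData 2 K hcpt)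
        (k : (K →+* ℂ) → ℕ) (w : ℤ), π.1.IsLAlgebraic →
        π.1.HasInfinityType (fun β : K →+* ℂ => ({(⟨((k β : ℂ) - 1 - w) / 2, (1 - (k β : ℂ) - w) / 2,
          (k β : ℤ) - 1, by push_cast; ring⟩ : Literature.NumberTheory.Automorphic.ArchWeight),
          (⟨((k β : ℂ) - 1 - w) / 2, (1 - (k β : ℂ) - w) / 2, (k β : ℤ) - 1, by push_cast; ring⟩ :
            Literature.NumberTheory.Automorphic.ArchWeight).swap} :
              Multiset Literature.NumberTheory.Automorphic.ArchWeight)) →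
        (∀ (u : NumberField.InfinitePlace K), ∀ φ ∈ π.1.W,
          Literature.NumberTheory.Automorphic.rightTranslation
              (Literature.NumberTheory.Automorphic.AdelicGroupData.gl 2 K)
              (Matrix.GeneralLinearGroup.scalar (Fin 2) (Units.map (MonoidHom.inl
                (NumberField.InfiniteAdeleRing K) (IsDedekindDomain.FiniteAdeleRing
                  (NumberField.RingOfIntegers K) K) : NumberField.InfiniteAdeleRing K →*
                    NumberField.AdeleRing (NumberField.RingOfIntegers K) K)
                (Units.map (MonoidHom.mulSingle (fun u' : NumberField.InfinitePlace K => u'.Completion)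
                  u : u.Completion →* NumberField.InfiniteAdeleRing K) (-1)))) φ + φ ∈ π.1.W') →
        (∃ β : K →+* ℂ, k β = 1) →
        ∀ (ℓ : ℕ) [Fact ℓ.Prime] (ι : PadicAlgCl ℓ ≃+* ℂ)
          (ρ : Literature.NumberTheory.GaloisRepresentations.FramedGaloisRep K (PadicAlgCl ℓ) 2),
          (∀ᶠ v : IsDedekindDomain.HeightOneSpectrum (NumberField.RingOfIntegers K) in Filter.cofinite,
            Summit.Langlands.SatakeFrobCompatibleAt ι π.1 ρ v) →
          ρ.toGaloisRep.IsIrreducible := by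
  sorry

/-! ## 2. The stub statements as named `Prop`s (literally their types) -/

namespace _Goal

/-- The statement of `stub_heckePseudocharacter`, as a named `Prop` (literally its type). [folklore] -/
def stub_heckePseudocharacter : Prop :=
  type_of% @Summit.Langlands.Langlands.Cruxes.OddNonRegularAttached.Birth.stub_heckePseudocharacter

/-- The statement of `stub_repOfPseudocharacter`, as a named `Prop` (literally its type). [folklore] -/
def stub_repOfPseudocharacter : Prop :=
  type_of% @Summit.Langlands.Langlands.Cruxes.OddNonRegularAttached.Birth.stub_repOfPseudocharacter

/-- The statement of `stub_cuspidalIrreducible`, as a named `Prop` (literally its type). [folklore] -/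
def stub_cuspidalIrreducible : Prop :=
  type_of% @Summit.Langlands.Langlands.Cruxes.OddNonRegularAttached.Birth.stub_cuspidalIrreducible

end _Goal

/-! ## 3. The composition (kernel-checked, no `sorry`): PSEUDOCHARACTER → REPRESENTATION → IRREDUCIBLE -/

/-- **`OddNonRegularAttached` from the three stubs.** Given `K, π, k, w` as in the crux and `ℓ, ι`:
`stub_heckePseudocharacter` gives `E`, a finite `S` and the pseudocharacter `T` with the Satake–Frobenius
polynomials of `π` off `S`; choosing those Satake parameters `α_v` and setting
`P v := arithFrobPolyOfSatake ι q_v 1 α_v` (junk `0` on `S`), `stub_repOfPseudocharacter` gives a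
semisimple `ρ` with `tr ρ = T`, unramified with `charpoly ρ(Frob_v) = P v` at every `v ∉ S`, i.e.
`SatakeFrobCompatibleAt ι π ρ v` off the finite `S`, hence at almost all `v`; `stub_cuspidalIrreducible`
makes this `ρ` irreducible. The hypotheses are, by name, the statements of the three stubs; the conclusion
is the route decl `Summit.Langlands.Langlands.Theses.SenNullAlignment.OddNonRegularAttached`. [folklore] -/
theorem OddNonRegularAttached_of (hT : _Goal.stub_heckePseudocharacter)
    (hR : _Goal.stub_repOfPseudocharacter) (hI : _Goal.stub_cuspidalIrreducible) :
    Summit.Langlands.Langlands.Theses.SenNullAlignment.OddNonRegularAttached := by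
  -- the stub statements, as the Π-types they literally are
  have h1 : type_of% @stub_heckePseudocharacter := hT
  have h2 : type_of% @stub_repOfPseudocharacter := hR
  have h3 : type_of% @stub_cuspidalIrreducible := hI
  intro K _ _ hK hcpt π k w hL hhol hodd hne ℓ _ ι
  -- PSEUDOCHARACTER: `E`, `S`, `T` and the Satake–Frobenius polynomials of `π` off `S`
  obtain ⟨E, S, T, hE, hS, hTE, hloc⟩ := h1 K hK hcpt π k w hL hhol hodd hne ℓ ι
  choose α hα using hloc
  -- the Frobenius polynomials to be interpolated (junk value `0` on `S`)
  let P : IsDedekindDomain.HeightOneSpectrum (NumberField.RingOfIntegers K) → Polynomial (PadicAlgCl ℓ) :=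
    fun v => if hv : v ∈ S then 0 else
      Literature.NumberTheory.Automorphic.arithFrobPolyOfSatake ι v.residueCard 1 (α v hv)
  have hP : ∀ (v) (hv : v ∉ S),
      P v = Literature.NumberTheory.Automorphic.arithFrobPolyOfSatake ι v.residueCard 1 (α v hv) :=
    fun v hv => dif_neg hv
  -- REPRESENTATION: Taylor's reconstruction with the local bookkeeping
  obtain ⟨ρ, -, -, hρ⟩ := h2 K ℓ E hE S T hTE P (fun v hv 𝔓 h𝔓 =>
    ⟨((hα v hv).2 𝔓 h𝔓).1, fun σ hσ => by rw [hP v hv]; exact ((hα v hv).2 𝔓 h𝔓).2 σ hσ⟩)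
  -- Satake–Frobenius compatibility off the finite set `S`, hence at almost all places
  have hae : ∀ᶠ v : IsDedekindDomain.HeightOneSpectrum (NumberField.RingOfIntegers K) in Filter.cofinite,
      Summit.Langlands.SatakeFrobCompatibleAt ι π.1 ρ v :=
    Filter.eventually_of_mem hS.compl_mem_cofinite fun v hv =>
      ⟨α v hv, (hα v hv).1, (hρ v hv).1, by rw [← hP v hv]; exact (hρ v hv).2⟩
  -- IRREDUCIBLE: Ribet's argument applied to this `ρ`
  exact ⟨ρ, h3 K hK hcpt π k w hL hhol hodd hne ℓ ι ρ hae, hae⟩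

/-- By-name sanity check (an `example`, not a declaration of the file): the three stubs feed the
composition as they stand. -/
example : Summit.Langlands.Langlands.Theses.SenNullAlignment.OddNonRegularAttached :=
  OddNonRegularAttached_of stub_heckePseudocharacter stub_repOfPseudocharacter stub_cuspidalIrreducible

end Summit.Langlands.Langlands.Cruxes.OddNonRegularAttached.Birth

end
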